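import Summits.HodgeConjecture.CorCM.TwoGroupCentraliserWords
import HarnessLib

/-!
# Case A of the order-`32` base: collection lemmas for the reduction of family CA2

COR-CM (cell `pub-hodgecm2`), binder seat b04 (gen 37), count-neutral own lane «Galois-CM-type classification».  KERNEL ONLY:
theorems; no definition, no named fact, no `sorry`.  Pure group theory (A7-JUNCTION gen-37 addendum): small word identities
in the letters `t, c` (commuting involutions, `c` central, `x t x⁻¹ = tc`), `a, b ∈ C(t)` and `x`, used to normalise the
eighteen raw bits of `CorCM/TwoGroupCaseARawBits` to the four free bits of the certificate families CA2-Id / CA2-Swap: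
constraints forced by `θ = (g ↦ x g x⁻¹)` being an automorphism with `θ² = conj(x²)` (`sq_bit_eq_zero`, `theta_sq_bit`, …), and the
substitutions `a ↦ a t^{q}`, `x ↦ x t^{q}` (`act_mul_tpow`, `sq_mul_tpow`, `xsq_mul_tpow`, …).

## References

* [Rotman1995] J. J. Rotman, *An Introduction to the Theory of Groups*, 4th ed., GTM 148, Ch. 5 and Ch. 7 (extensions).
-/

namespace Summit.HodgeConjecture.CorCM.GaloisModels.CaseA

open Summit.HodgeConjecture.CorCM.GaloisTableLaws (zmod2_cases)

variable {G : Type*} [Group G]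

/-! ## §1 Bits of `c` -/

/-- `c ≠ 1`, `c² = 1`: `c^{z} = 1 ⟹ z = 0` on bits. [folklore] -/
theorem bit_eq_zero_of_cpow {c : G} (hc1 : c ≠ 1) {z : ZMod 2} (h : c ^ z.val = 1) : z = 0 := by
  rcases zmod2_cases z with rfl | rfl
  · rfl
  · rw [show (1 : ZMod 2).val = 1 from rfl, pow_one] at h; exact (hc1 h).elim

/-- `c ≠ 1`, `c² = 1`: `c^{z} = c^{w} ⟹ z = w` on bits. [folklore] -/
theorem bit_eq_of_cpow_eq {c : G} (hcc : c * c = 1) (hc1 : c ≠ 1) {z w : ZMod 2} (h : c ^ z.val = c ^ w.val) : z = w := by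
  have h1 : c ^ (z + w).val = 1 := by
    rw [FrattiniTwo.invol_pow_add hcc, h, ← FrattiniTwo.invol_pow_add hcc,
      show (w + w).val = 0 by rcases zmod2_cases w with rfl | rfl <;> rfl, pow_zero]
  have h2 := bit_eq_zero_of_cpow hc1 h1
  have h3 : ∀ z w : ZMod 2, z + w = 0 → z = w := by decide
  exact h3 _ _ h2

/-! ## §2 Conjugation by `x` -/

/-- `x t x⁻¹ = t c`, `c` central involution: `x (tᵖ c^q) x⁻¹ = tᵖ c^{p+q}`. [folklore] -/
theorem conj_tc_word {t c x : G} (hcc : c * c = 1) (hcen : ∀ g : G, c * g = g * c) (htc : t * c = c * t)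
    (hxt : x * t * x⁻¹ = t * c) (p q : ZMod 2) :
    x * (t ^ p.val * c ^ q.val) * x⁻¹ = t ^ p.val * c ^ (p + q).val := by
  have hxc : x * c * x⁻¹ = c := by rw [← hcen x]; group
  rw [show x * (t ^ p.val * c ^ q.val) * x⁻¹ = (x * t * x⁻¹) ^ p.val * (x * c * x⁻¹) ^ q.val by
    rw [conj_pow, conj_pow]; group, hxt, hxc, (show Commute t c from htc).mul_pow, mul_assoc,
    ← FrattiniTwo.invol_pow_add hcc]

/-- **`θ(g)² = θ(g²)` on bits**: `g ∈ C(t)` with `g² = t^{α₁}c^{α₂}` and `x g x⁻¹ = tᵖ c^q g` ⟹ `α₁ = 0`. [folklore] -/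
theorem sq_bit_eq_zero {t c x g : G} (hcc : c * c = 1) (hc1 : c ≠ 1) (hcen : ∀ h : G, c * h = h * c)
    (htt : t * t = 1) (hxt : x * t * x⁻¹ = t * c) (hgt : g * t = t * g) {α₁ α₂ p q : ZMod 2}
    (hgg : g * g = t ^ α₁.val * c ^ α₂.val) (hxg : x * g * x⁻¹ = t ^ p.val * c ^ q.val * g) : α₁ = 0 := by
  have htc : t * c = c * t := (hcen t).symm
  -- `(x g x⁻¹)² = g²`
  have hw : ∀ p q : ZMod 2, t ^ p.val * c ^ q.val * g = g * (t ^ p.val * c ^ q.val) := fun p q =>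
    (((show Commute t g from hgt.symm).pow_left _).mul_left ((show Commute c g from hcen g).pow_left _)).eq
  have h1 : (x * g * x⁻¹) * (x * g * x⁻¹) = t ^ α₁.val * c ^ α₂.val := by
    rw [hxg, show t ^ p.val * c ^ q.val * g * (t ^ p.val * c ^ q.val * g) =
      t ^ p.val * c ^ q.val * (g * (t ^ p.val * c ^ q.val)) * g by group, ← hw, show
      t ^ p.val * c ^ q.val * (t ^ p.val * c ^ q.val * g) * g = (t ^ p.val * c ^ q.val * (t ^ p.val * c ^ q.val)) * (g * g)
      by group, invol_word_mul htt hcc htc, show (p + p).val = 0 by rcases zmod2_cases p with rfl | rfl <;> rfl,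
      show (q + q).val = 0 by rcases zmod2_cases q with rfl | rfl <;> rfl, pow_zero, pow_zero, one_mul, one_mul, hgg]
  -- `= x g² x⁻¹ = t^{α₁} c^{α₁ + α₂}`
  have h2 : (x * g * x⁻¹) * (x * g * x⁻¹) = t ^ α₁.val * c ^ (α₁ + α₂).val := by
    rw [show (x * g * x⁻¹) * (x * g * x⁻¹) = x * (g * g) * x⁻¹ by group, hgg, conj_tc_word hcc hcen htc hxt]
  rw [h1] at h2
  have h3 := mul_left_cancel h2
  have h4 := bit_eq_of_cpow_eq hcc hc1 h3
  have h5 : ∀ z w : ZMod 2, w = z + w → z = 0 := by decide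
  exact h5 _ _ h4

/-- **`θ²(g) = g` on bits**: `x g x⁻¹ = tᵖ c^q g` and `x² g x⁻² = g c^{s}` ⟹ `p = s`. (Here `x² g x⁻²` is supplied as a
hypothesis computed from `x² ∈ C(t)`.) [folklore] -/
theorem theta_sq_bit {t c x g : G} (hcc : c * c = 1) (hc1 : c ≠ 1) (hcen : ∀ h : G, c * h = h * c) (htt : t * t = 1)
    (hxt : x * t * x⁻¹ = t * c) {p q s : ZMod 2} (hxg : x * g * x⁻¹ = t ^ p.val * c ^ q.val * g)
    (hx2 : x * x * g * (x * x)⁻¹ = g * c ^ s.val) : p = s := by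
  have htc : t * c = c * t := (hcen t).symm
  have h1 : x * x * g * (x * x)⁻¹ = x * (x * g * x⁻¹) * x⁻¹ := by group
  rw [hxg, show x * (t ^ p.val * c ^ q.val * g) * x⁻¹ = (x * (t ^ p.val * c ^ q.val) * x⁻¹) * (x * g * x⁻¹) by group,
    conj_tc_word hcc hcen htc hxt, hxg, hx2] at h1
  -- `g c^s = tᵖ c^{p+q} (tᵖ c^q g) = c^{p} g`
  rw [show t ^ p.val * c ^ (p + q).val * (t ^ p.val * c ^ q.val * g) = (t ^ p.val * c ^ (p + q).val * (t ^ p.val * c ^ q.val)) * g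
    by group, invol_word_mul htt hcc htc, show (p + p).val = 0 by rcases zmod2_cases p with rfl | rfl <;> rfl, pow_zero,
    one_mul, show p + q + q = p from (by decide : ∀ p q : ZMod 2, p + q + q = p) p q,
    ((show Commute c g from hcen g).pow_left _).eq] at h1
  exact (bit_eq_of_cpow_eq hcc hc1 (mul_left_cancel h1)).symm

/-! ## §3 The substitutions `g ↦ g t^{q}`, `x ↦ x t^{q}` -/

/-- `x (g tʳ) = tᵖ (g tʳ) x` when `x g = tᵖ cʳ g x` (the `c`-part of `θ(g)` is absorbed by `g ↦ g tʳ`). [folklore] -/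
theorem act_mul_tpow {t c x g : G} (hcc : c * c = 1) (hcen : ∀ h : G, c * h = h * c) (hxt : x * t * x⁻¹ = t * c)
    {p r : ZMod 2} (hxg : x * g = t ^ p.val * c ^ r.val * g * x) :
    x * (g * t ^ r.val) = t ^ p.val * (g * t ^ r.val) * x := by
  have hxt' : x * t = t * c * x := by rw [← hxt]; group
  rcases zmod2_cases r with rfl | rfl
  · simp only [ZMod.val_zero, pow_zero, mul_one] at hxg ⊢; exact hxg
  · rw [show (1 : ZMod 2).val = 1 from rfl, pow_one] at hxg ⊢
    calc x * (g * t) = (x * g) * t := (mul_assoc _ _ _).symm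
      _ = t ^ p.val * c * g * (x * t) := by rw [hxg]; group
      _ = t ^ p.val * c * g * (t * c * x) := by rw [hxt']
      _ = t ^ p.val * (g * t) * (c * c) * x := by
          rw [show t ^ p.val * c * g * (t * c * x) = t ^ p.val * (c * (g * t)) * c * x by group, hcen (g * t)]; group
      _ = t ^ p.val * (g * t) * x := by rw [hcc, mul_one]

/-- `(g tʳ)² = g²` for `g ∈ C(t)`, `t² = 1`. [folklore] -/
theorem sq_mul_tpow {t g : G} (htt : t * t = 1) (hgt : g * t = t * g) (r : ZMod 2) :
    g * t ^ r.val * (g * t ^ r.val) = g * g := by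
  rcases zmod2_cases r with rfl | rfl
  · rw [ZMod.val_zero, pow_zero, mul_one]
  · rw [show (1 : ZMod 2).val = 1 from rfl, pow_one, show g * t * (g * t) = g * (t * g) * t by group, ← hgt]
    rw [show g * (g * t) * t = g * g * (t * t) by group, htt, mul_one]

/-- `(b tˢ)(a tʳ) = (a tʳ)(b tˢ) n` when `b a = a b n` (`a, b ∈ C(t)`). [folklore] -/
theorem comm_mul_tpow {t a b n : G} (hat : a * t = t * a) (hbt : b * t = t * b) (hnt : n * t = t * n)
    (hba : b * a = a * b * n) (r s : ZMod 2) :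
    b * t ^ s.val * (a * t ^ r.val) = a * t ^ r.val * (b * t ^ s.val) * n := by
  have h1 : Commute (t ^ s.val) a := (show Commute t a from hat.symm).pow_left _
  have h2 : Commute (t ^ s.val) (t ^ r.val) := (Commute.refl t).pow_pow _ _
  have h3 : Commute (t ^ r.val) b := (show Commute t b from hbt.symm).pow_left _
  have h4 : Commute (t ^ r.val) n := (show Commute t n from hnt.symm).pow_left _
  have h5 : Commute (t ^ s.val) n := (show Commute t n from hnt.symm).pow_left _
  calc b * t ^ s.val * (a * t ^ r.val) = b * (t ^ s.val * a) * t ^ r.val := by group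
    _ = b * (a * t ^ s.val) * t ^ r.val := by rw [h1.eq]
    _ = (b * a) * (t ^ s.val * t ^ r.val) := by group
    _ = (a * b * n) * (t ^ r.val * t ^ s.val) := by rw [hba, h2.eq]
    _ = a * (b * (n * t ^ r.val)) * t ^ s.val := by group
    _ = a * (b * (t ^ r.val * n)) * t ^ s.val := by rw [h4.symm.eq]
    _ = a * ((b * t ^ r.val) * (n * t ^ s.val)) := by group
    _ = a * ((t ^ r.val * b) * (t ^ s.val * n)) := by rw [h3.symm.eq, h5.symm.eq]
    _ = a * t ^ r.val * (b * t ^ s.val) * n := by group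

/-- `x' = x tʳ` conjugates like `x` on `C(t)`. [folklore] -/
theorem conj_mul_tpow {t x g : G} (hgt : g * t = t * g) (r : ZMod 2) :
    x * t ^ r.val * g * (x * t ^ r.val)⁻¹ = x * g * x⁻¹ := by
  have h : Commute (t ^ r.val) g := (show Commute t g from hgt.symm).pow_left _
  calc x * t ^ r.val * g * (x * t ^ r.val)⁻¹ = x * (t ^ r.val * g) * (t ^ r.val)⁻¹ * x⁻¹ := by group
    _ = x * (g * t ^ r.val) * (t ^ r.val)⁻¹ * x⁻¹ := by rw [h.eq]
    _ = x * g * x⁻¹ := by group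

/-- `(x tʳ)² = x² cʳ` (`x t x⁻¹ = tc`, `c` central involution, `t² = 1`). [folklore] -/
theorem xsq_mul_tpow {t c x : G} (hcc : c * c = 1) (hcen : ∀ h : G, c * h = h * c) (htt : t * t = 1)
    (hxt : x * t * x⁻¹ = t * c) (r : ZMod 2) : x * t ^ r.val * (x * t ^ r.val) = x * x * c ^ r.val := by
  rcases zmod2_cases r with rfl | rfl
  · rw [ZMod.val_zero, pow_zero, pow_zero, mul_one, mul_one]
  · rw [show (1 : ZMod 2).val = 1 from rfl, pow_one, pow_one]
    -- `t x = x t c` (from `x⁻¹ t x = t c`, i.e. `t = x t c x⁻¹`)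
    have h1 : t * x = x * (t * c) := by
      have h2 : x * t = t * c * x := by rw [← hxt]; group
      -- `t x = x t c` ⟺ `x⁻¹ t x = t c`; from `x t x⁻¹ = t c`: `t = x⁻¹ (t c) x`... use `c` central: `x t = t c x ⟹ x t c = t x`
      have h3 : x * (t * c) = t * x := by
        rw [← mul_assoc, h2, show t * c * x * c = t * (c * (x * c)) by group, ← hcen x, show t * (c * (c * x)) = t * (c * c) * x
          by group, hcc, mul_one]
      exact h3.symm
    calc x * t * (x * t) = x * (t * x) * t := by group
      _ = x * (x * (t * c)) * t := by rw [h1]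
      _ = x * x * (t * (c * t)) := by group
      _ = x * x * (t * (t * c)) := by rw [hcen t]
      _ = x * x * ((t * t) * c) := by group
      _ = x * x * c := by rw [htt, one_mul]

/-- Side condition transfer: `a tʳ ∉ {tᵖ c^q}` when `a ∉ {tᵖ c^q}`. [folklore] -/
theorem not_word_mul_tpow {t c a : G} (htt : t * t = 1) (htc : t * c = c * t)
    (ha : ∀ p q : ZMod 2, a ≠ t ^ p.val * c ^ q.val) (r : ZMod 2) :
    ∀ p q : ZMod 2, a * t ^ r.val ≠ t ^ p.val * c ^ q.val := by
  intro p q h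
  apply ha (p + r) q
  have h1 : a = t ^ p.val * c ^ q.val * (t ^ r.val)⁻¹ := by rw [← h]; group
  rw [h1, show (t ^ r.val)⁻¹ = t ^ r.val by
    rw [inv_eq_iff_mul_eq_one, ← FrattiniTwo.invol_pow_add htt,
      show (r + r).val = 0 by rcases zmod2_cases r with rfl | rfl <;> rfl, pow_zero], mul_assoc,
    ((show Commute t c from htc).symm.pow_pow _ _).eq, ← mul_assoc, ← FrattiniTwo.invol_pow_add htt]

/-- Side condition transfer: `b tˢ ∉ {tᵖ c^q (a tʳ)ⁱ}` when `b ∉ {tᵖ c^q aⁱ}` (`a ∈ C(t)`). [folklore] -/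
theorem not_word₃_mul_tpow {t c a b : G} (htt : t * t = 1) (htc : t * c = c * t) (hat : a * t = t * a)
    (hb : ∀ p q i : ZMod 2, b ≠ t ^ p.val * (c ^ q.val * a ^ i.val)) (r s : ZMod 2) :
    ∀ p q i : ZMod 2, b * t ^ s.val ≠ t ^ p.val * (c ^ q.val * (a * t ^ r.val) ^ i.val) := by
  intro p q i h
  have hv1 : (1 : ZMod 2).val = 1 := rfl
  have hct : Commute c t := (show Commute t c from htc).symm
  have hat' : Commute a t := hat
  have hts : b = t ^ p.val * (c ^ q.val * (a * t ^ r.val) ^ i.val) * t ^ s.val := by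
    rw [← h, mul_assoc, ← FrattiniTwo.invol_pow_add htt,
      show (s + s).val = 0 by rcases zmod2_cases s with rfl | rfl <;> rfl, pow_zero, mul_one]
  rcases zmod2_cases i with rfl | rfl
  · apply hb (p + s) q 0
    rw [hts]
    simp only [ZMod.val_zero, pow_zero, mul_one]
    rw [mul_assoc, (hct.pow_pow _ _).eq, ← mul_assoc, ← FrattiniTwo.invol_pow_add htt]
  · apply hb (p + r + s) q 1
    rw [hts]
    simp only [hv1, pow_one]
    have h1 : c ^ q.val * (a * t ^ r.val) = t ^ r.val * (c ^ q.val * a) := by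
      rw [← mul_assoc]; exact (((hct.pow_pow _ _).mul_left (hat'.pow_right _))).eq
    have h2 : c ^ q.val * a * t ^ s.val = t ^ s.val * (c ^ q.val * a) :=
      (((hct.pow_pow _ _).mul_left (hat'.pow_right _))).eq
    rw [h1, show t ^ p.val * (t ^ r.val * (c ^ q.val * a)) * t ^ s.val = t ^ p.val * t ^ r.val * (c ^ q.val * a * t ^ s.val)
      by group, h2, ← mul_assoc, ← FrattiniTwo.invol_pow_add htt, ← FrattiniTwo.invol_pow_add htt]

/-! ## §4 The commutator bit -/

/-- **`θ([b,a]) = [θb, θa]` on bits**: `ba = ab t^{γ₁}c^{γ₂}`, `x a x⁻¹ = n_a a`, `x b x⁻¹ = n_b b` (`n_a, n_b` words in `t, c`)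
⟹ `γ₁ = 0`. [folklore] -/
theorem comm_bit_eq_zero {t c x a b : G} (hcc : c * c = 1) (hc1 : c ≠ 1) (hcen : ∀ h : G, c * h = h * c)
    (htt : t * t = 1) (hxt : x * t * x⁻¹ = t * c) (hat : a * t = t * a) (hbt : b * t = t * b)
    {γ₁ γ₂ p₁ q₁ p₂ q₂ : ZMod 2} (hba : b * a = a * b * (t ^ γ₁.val * c ^ γ₂.val))
    (hxa : x * a * x⁻¹ = t ^ p₁.val * c ^ q₁.val * a) (hxb : x * b * x⁻¹ = t ^ p₂.val * c ^ q₂.val * b) : γ₁ = 0 := by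
  have htc : t * c = c * t := (hcen t).symm
  have hwa : ∀ p q : ZMod 2, t ^ p.val * c ^ q.val * a = a * (t ^ p.val * c ^ q.val) := fun p q =>
    (((show Commute t a from hat.symm).pow_left _).mul_left ((show Commute c a from hcen a).pow_left _)).eq
  have hwb : ∀ p q : ZMod 2, t ^ p.val * c ^ q.val * b = b * (t ^ p.val * c ^ q.val) := fun p q =>
    (((show Commute t b from hbt.symm).pow_left _).mul_left ((show Commute c b from hcen b).pow_left _)).eq
  have hww : ∀ p q p' q' : ZMod 2, t ^ p.val * c ^ q.val * (t ^ p'.val * c ^ q'.val) =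
      t ^ p'.val * c ^ q'.val * (t ^ p.val * c ^ q.val) := fun p q p' q' => by
    rw [invol_word_mul htt hcc htc, invol_word_mul htt hcc htc, add_comm p, add_comm q]
  -- conjugate `b a = a b n` by `x`
  have h1 : x * (b * a) * x⁻¹ = (t ^ p₂.val * c ^ q₂.val * b) * (t ^ p₁.val * c ^ q₁.val * a) := by
    rw [show x * (b * a) * x⁻¹ = (x * b * x⁻¹) * (x * a * x⁻¹) by group, hxa, hxb]
  have h2 : x * (a * b * (t ^ γ₁.val * c ^ γ₂.val)) * x⁻¹ =
      (t ^ p₁.val * c ^ q₁.val * a) * (t ^ p₂.val * c ^ q₂.val * b) * (t ^ γ₁.val * c ^ (γ₁ + γ₂).val) := by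
    rw [show x * (a * b * (t ^ γ₁.val * c ^ γ₂.val)) * x⁻¹ = (x * a * x⁻¹) * (x * b * x⁻¹) *
      (x * (t ^ γ₁.val * c ^ γ₂.val) * x⁻¹) by group, hxa, hxb, conj_tc_word hcc hcen htc hxt]
  rw [hba] at h1
  rw [h1] at h2
  -- normalise both sides to `n_a n_b (a b) w`
  have h3 : (t ^ p₂.val * c ^ q₂.val * b) * (t ^ p₁.val * c ^ q₁.val * a) =
      t ^ p₁.val * c ^ q₁.val * (t ^ p₂.val * c ^ q₂.val) * (a * b) * (t ^ γ₁.val * c ^ γ₂.val) := by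
    calc (t ^ p₂.val * c ^ q₂.val * b) * (t ^ p₁.val * c ^ q₁.val * a)
        = t ^ p₂.val * c ^ q₂.val * (b * (t ^ p₁.val * c ^ q₁.val)) * a := by group
      _ = t ^ p₂.val * c ^ q₂.val * (t ^ p₁.val * c ^ q₁.val * b) * a := by rw [hwb]
      _ = t ^ p₂.val * c ^ q₂.val * (t ^ p₁.val * c ^ q₁.val) * (b * a) := by group
      _ = t ^ p₁.val * c ^ q₁.val * (t ^ p₂.val * c ^ q₂.val) * (a * b * (t ^ γ₁.val * c ^ γ₂.val)) := by rw [hww, hba]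
      _ = _ := by group
  have h4 : (t ^ p₁.val * c ^ q₁.val * a) * (t ^ p₂.val * c ^ q₂.val * b) * (t ^ γ₁.val * c ^ (γ₁ + γ₂).val) =
      t ^ p₁.val * c ^ q₁.val * (t ^ p₂.val * c ^ q₂.val) * (a * b) * (t ^ γ₁.val * c ^ (γ₁ + γ₂).val) := by
    rw [show (t ^ p₁.val * c ^ q₁.val * a) * (t ^ p₂.val * c ^ q₂.val * b) =
      t ^ p₁.val * c ^ q₁.val * (a * (t ^ p₂.val * c ^ q₂.val)) * b by group, ← hwa]
    group
  rw [h3, h4] at h2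
  have h5 := mul_left_cancel (mul_left_cancel h2)
  have h6 := (bit_eq_of_cpow_eq hcc hc1 h5)
  have h7 : ∀ z w : ZMod 2, w = z + w → z = 0 := by decide
  exact h7 _ _ h6

end Summit.HodgeConjecture.CorCM.GaloisModels.CaseA
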